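import Mathlib
import Summits.Ventures.PercRepro.PuncturedLYMMixT3Q2Table1
import Summits.Ventures.PercRepro.PuncturedLYMMixT3Q2Table2

/-!
# PercRepro — (SP) FOR `3` PAIRWISE DISJOINT TRIPLES AND `2` PAIRWISE DISJOINT QUADRUPLES AT LEVEL `4`: POSITIVITY OF THE DENOMINATORS (1)
(p10, gen 41)

`den > 0`, `Pc > 0` for `n ≥ 17`; `Yc > 0` for `n ≥ 5`.  Nothing here asserts (SP).
-/

namespace PercRepro.PuncturedLYM.Split.TypeLift.MixT3Q2

/-- `den > 0` for `n ≥ 17`. -/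
theorem den_pos (n : ℚ) (hn : 17 ≤ n) : 0 < den n := by
  obtain ⟨n', hn', rfl⟩ : ∃ n', 0 ≤ n' ∧ n = 17 + n' := ⟨n - 17, by linarith, by ring⟩
  have h : den (17 + n') = 746496 * n' ^ 20 + 227059200 * n' ^ 19 + 32791334976 * n' ^ 18 + 2989570508928 * n' ^ 17 + 192968184777120 * n' ^ 16 + 9373479449459904 * n' ^ 15 + 355525654600519524 * n' ^ 14 + 10781618960235824352 * n' ^ 13 + 265498125454199813712 * n' ^ 12 + 5361097418224965309840 * n' ^ 11 + 89251959600601827857688 * n' ^ 10 + 1227165055897406161091568 * n' ^ 9 + 13910332355518768891716912 * n' ^ 8 + 129283102441114330995548784 * n' ^ 7 + 975535172926388275345022820 * n' ^ 6 + 5884329431018180539593643440 * n' ^ 5 + 27707253431914623091978265856 * n' ^ 4 + 98150644378817425497776987712 * n' ^ 3 + 246072189132638516958784904640 * n' ^ 2 + 389297528181116036343449487360 * n' + 292285124943454585965006028800 := by unfold den; ring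
  rw [h]; positivity

/-- `Yc > 0` for `n ≥ 5`. -/
theorem Yc_pos (n : ℚ) (hn : 5 ≤ n) : 0 < Yc n := by
  obtain ⟨n', hn', rfl⟩ : ∃ n', 0 ≤ n' ∧ n = 5 + n' := ⟨n - 5, by linarith, by ring⟩
  have h : Yc (5 + n') = (1 / 120) * n' ^ 5 + (1 / 8) * n' ^ 4 + (17 / 24) * n' ^ 3 + (15 / 8) * n' ^ 2 + (137 / 60) * n' + 1 := by unfold Yc; ring
  rw [h]; positivity

/-- `Pc > 0` for `n ≥ 17`. -/
theorem Pc_pos (n : ℚ) (hn : 17 ≤ n) : 0 < Pc n := by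
  obtain ⟨n', hn', rfl⟩ : ∃ n', 0 ≤ n' ∧ n = 17 + n' := ⟨n - 17, by linarith, by ring⟩
  have h : Pc (17 + n') = (1 / 24) * n' ^ 4 + (31 / 12) * n' ^ 3 + (1439 / 24) * n' ^ 2 + (7373 / 12) * n' + 2336 := by unfold Pc; ring
  rw [h]; positivity

end PercRepro.PuncturedLYM.Split.TypeLift.MixT3Q2
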